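import Summits.BirchSwinnertonDyer.Rank1Residual.P2.CongruentNumberSilentEvenFiveEnclosure
import Literature.NumberTheory.EllipticCurves.Tian2014.CMPointSystemGenusBridge
import HarnessLib

/-!
# Cell «bsd-monsky» (typer): THE ENCLOSURE, referee-preferred form — C-P2-1 relative to Monsky 1990 Cor 5.15 and the
# RESTATED system fact `tian2014_system_sMinus_genus` (`Printed ∧ GrossZagierScriptL ∧ GenusTheoryDisplays`)

HONEST FRAMING: nothing asserted; conditional on `h515` (in the tree) and on the displayed fact `hSys` (Tian's CM-point
system on `𝒮⁻`: Thm. 2.8 system, the (B4)-flagged Gross–Zagier index relation, Gauss genus theory as printed). Monsky's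
inputs (Lemma 4.1, Thm. 4.7's class, the genus facts, Lemmas 5.4 / 5.8) are THEOREMS here (prover-A's
`Monsky1990/DescentLemma*` chain + the bridges of `Tian2014/CMPointSystemGenusBridge.lean`). Per the referee's
admissibility delta-read (`REFEREE-DISPLAYS-ADMISSIBILITY-2.md` §3) this is the preferred form; the conjecture `Prop`s
stay `@[conjecture]` until `hSys` is a Literature fact of the tree. References: HOME `lean/PLAN.md` v0.6,
`Enclosure_genus_check.lean`.
-/

noncomputable section

open scoped Classical

open Literature.NumberTheory.EllipticCurves.Monsky1990

set_option autoImplicit false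

namespace Summit.BirchSwinnertonDyer.Rank1Residual.P2

open Conjectures Literature.NumberTheory.EllipticCurves.Tian2014

/-- **THE ENCLOSURE, referee-preferred form: C-P2-1 relative to Monsky 1990 Cor 5.15 and the restated system fact**
(`Printed ∧ GrossZagierScriptL ∧ GenusTheoryDisplays` for Tian's actual system on `𝒮⁻`). Sorry-free; nothing asserted.
`h515` is the tree's `Monsky1990.cor515_rank_eq_one_and_card_selmerGroup_two` = Cor. 5.15 (p. 66) with Remark (2) (p. 67:
rank exactly one and `S̄ = ℤ/2`) — «(2′)» in earlier cell notes is an in-house label for that pairing, not a printed item number.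
[cite: Monsky1990MockHeegner, Cor. 5.15 (p. 66), Remark (2) (p. 67)] [cite: Tian2014, Thm. 2.8 (J132), Notations (J122–123)]
[cite: TianYuanZhang2017, Thm. 3.3] [cite: Miller2011LMS, Def. 1.1] -/
theorem congruentSilentEvenFiveBSDTwo_of_genusSystem
    (h515 : cor515_rank_eq_one_and_card_selmerGroup_two) (hSys : tian2014_system_sMinus_genus) :
    CongruentSilentEvenFiveBSDTwo :=
  congruentSilentEvenFiveBSDTwo_of_system h515 (tian2014_monsky1990_system_sMinus_of_genus hSys)

end Summit.BirchSwinnertonDyer.Rank1Residual.P2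

end
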